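import Summits.AnomalousDissipation.AnomalousDissipation.Theorems.PointSinkPointFluxConeBoxStepTools
import HarnessLib

/-!
# Stub `stub_boxStep` — the perturbation step in the unit box of `ℝ³`, with pressure
(crux `PointSink.PointFluxCone`, stmt-AnomalousDissipation-19033, line `Sketch`)

§2 Step 3 of Choffrut–Székelyhidi 2014 ("property (P) with an easy covering and rescaling
argument") in the open unit box `(0,1)³ ⊂ ℝ³` instead of the flat torus, with the packet pressure
carried along: for a continuous energy profile `e` on `ℝ³`, a continuous state field `w` with
`w(x) ∈ 𝒰_{e(x)}` for all `x`, finitely many continuous test fields `p_a` and `ε, δ > 0`, there is a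
grid packet (rescaled copies of finitely many reference packets on the cells of mesh `m⁻¹` of the
fundamental cube, `StationaryEuler.gridPacket`) whose field `W` satisfies

* `w(x) + W(x) ∈ 𝒰_{e(x)}` for all `x`,
* `|∫ ⟪W, p_a⟫| ≤ ε` (near-orthogonality, from the cellwise mean zero),
* `|prC| ≤ δ` pointwise (each reference packet has `|prC| ≤ δ`, hypothesis PPK),
* `∫ ‖W‖² ≥ ∫_{box} (e − |v|²) − ε` (laminate gain realised by PPK, re-boxed into the cells).

The proof is the tree's `StationaryEuler.step` (`Literature/Analysis/FluidPDE/StationaryEulerStep.lean`)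
with the torus replaced by the closed ball containing the fundamental cube (compact: finite subcover,
Lebesgue number, mesh), the pointwise data `StationaryEuler.exists_pointData` replaced by
`boxStep_pointData` (PPK + re-boxing with pressure + joint margins of `HighDim.relaxedFamily`), and
the `H⁻¹` clause dropped; the tools are in `PointSinkPointFluxConeBoxStepTools.lean`.

References: A. Choffrut, L. Székelyhidi Jr., *Weak solutions to the stationary incompressible Euler
equations*, SIAM J. Math. Anal. 46 (2014), §2 Step 3, Prop. 6, Cor. 16.
-/

noncomputable section

open scoped InnerProductSpace ContDiff ENNReal Topology
open Set Function MeasureTheory Metric Filter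
open Literature.Analysis.FluidPDE Literature.Analysis.FluidPDE.StationaryEuler
open Literature.Analysis.FunctionSpaces

set_option linter.dupNamespace false

namespace Summit.AnomalousDissipation.AnomalousDissipation.Theorems

/-! ## The step in the box -/

/-- **PPK → STEP (§2 Step 3 in the unit box of `ℝ³`, with pressure).** For a continuous energy
profile `e` on `ℝ³`, a continuous state field `w` with `w(x) ∈ 𝒰_{e(x)}` for all `x`, finitely many
continuous test fields and `ε, δ > 0`, there is a grid packet of some mesh `m⁻¹` on the unit box
(reference packets supported in the open box) whose field `W` satisfies `w + W ∈ 𝒰_e` pointwise,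
`|∫⟪W, p_a⟫| ≤ ε`, `|prC| ≤ δ` pointwise, and `∫‖W‖² ≥ ∫_{box}(e − |v|²) − ε`: pointwise data from
PPK (re-boxed, with joint margins), a finite subcover of the closed ball containing the cube and its
Lebesgue number, a fine mesh (Lebesgue number and oscillation of the test fields), one reference
packet per cell. [cite: ChoffrutSzekelyhidi2014, §2, Step 3] -/
theorem stub_boxStep :
    (∀ (r : ℝ) (w : State (Fin 3)) (ε δ : ℝ), w ∈ HighDim.U r → 0 < ε → 0 < δ →
      ∃ (F : Ed (Fin 3) ≃ₗᵢ[ℝ] Ed (Fin 3)) (P : Packet (Fin 3)), P.SuppIn (refCube F) ∧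
        (∀ x, w + P.field x ∈ HighDim.U r) ∧
        r - ‖vel w‖ ^ 2 - ε ≤ ∫ x, ‖P.field x‖ ^ 2 ∧
        ∀ x, |P.prC x| ≤ δ) →
    (∀ (e : Ed (Fin 3) → ℝ) (w : Ed (Fin 3) → State (Fin 3)) (N : ℕ)
      (p : Fin N → Ed (Fin 3) → State (Fin 3)) (ε δ : ℝ),
      Continuous e → Continuous w → (∀ x, w x ∈ HighDim.U (e x)) → (∀ a, Continuous (p a)) →
      0 < ε → 0 < δ →
      ∃ (m : ℕ) (hm : 0 < m) (Q : (Fin 3 → ℤ) → Packet (Fin 3)),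
        (∀ κ, Packet.SuppIn (box (Fin 3)) (Q κ)) ∧
        (∀ x, w x + Packet.field (gridPacket hm Q) x ∈ HighDim.U (e x)) ∧
        (∀ a, |∫ x, ⟪Packet.field (gridPacket hm Q) x, p a x⟫_ℝ| ≤ ε) ∧
        (∀ x, |Packet.prC (gridPacket hm Q) x| ≤ δ) ∧
        (∫ x in box (Fin 3), (e x - ‖vel (w x)‖ ^ 2)) - ε ≤
          ∫ x, ‖Packet.field (gridPacket hm Q) x‖ ^ 2) := by
  -- adapted from Literature/Analysis/FluidPDE/StationaryEulerStep.lean (`step`)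
  intro hP e w N p ε δ he hwc hw hp hε hδ
  have hε4 : 0 < ε / 4 := by positivity
  -- Step 1: pointwise data
  choose Pk δk hδk hPk_supp hPk_marg hPk_gain hPk_δ using
    fun x₀ : Ed (Fin 3) => boxStep_pointData hP (hw x₀) hε4 hδ
  -- the defect density
  set g : Ed (Fin 3) → ℝ := fun x => e x - ‖vel (w x)‖ ^ 2 with hg
  have hgc : Continuous g := he.sub ((continuous_norm.comp (continuous_vel.comp hwc)).pow 2)
  have hg0 : ∀ x, 0 ≤ g x := fun x => sub_nonneg.2 (norm_vel_sq_le_of_mem_C (HighDim.U_subset_C _ (hw x)))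
  -- Step 2: the open cover of the closed ball containing the cube, and a finite subcover
  set O : Ed (Fin 3) → Set (Ed (Fin 3)) := fun a =>
    {x | |e x - e a| < δk a / 2 ∧ dist (w x) (w a) < δk a / 2 ∧ |g x - g a| < ε / 4} with hO
  have hOo : ∀ a, IsOpen (O a) := fun a =>
    IsOpen.inter (isOpen_lt (continuous_abs.comp (he.sub continuous_const)) continuous_const)
      (IsOpen.inter (isOpen_lt (hwc.dist continuous_const) continuous_const)
        (isOpen_lt (continuous_abs.comp (hgc.sub continuous_const)) continuous_const))
  have hOmem : ∀ a, a ∈ O a := fun a => by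
    simp only [hO, mem_setOf_eq, sub_self, abs_zero, dist_self]
    exact ⟨half_pos (hδk a), half_pos (hδk a), hε4⟩
  set Kb : Set (Ed (Fin 3)) := closedBall (0 : Ed (Fin 3)) (Fintype.card (Fin 3)) with hKb
  have hKc : IsCompact Kb := isCompact_closedBall _ _
  obtain ⟨t, ht⟩ := hKc.elim_finite_subcover O hOo fun x _ => mem_iUnion.2 ⟨x, hOmem x⟩
  -- common bound of the finitely many reference fields
  have hbd : ∀ a, ∃ B, ∀ y, ‖Packet.field (Pk a) y‖ ≤ B := fun a => by
    obtain ⟨B, hB⟩ := (isCompact_range_field (Pk a)).isBounded.exists_norm_le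
    exact ⟨B, fun y => hB _ ⟨y, rfl⟩⟩
  choose B hB using hbd
  obtain ⟨M, hM0, hM⟩ := exists_common_bound t B
  have hMt : ∀ a ∈ t, ∀ y, ‖Packet.field (Pk a) y‖ ≤ M := fun a ha y => (hB a y).trans (hM a ha)
  -- Step 3: Lebesgue number of the cover on the closed ball
  obtain ⟨lam, hlam, hleb⟩ := lebesgue_number_lemma_of_metric hKc (c := fun a : t => O a)
    (fun a => hOo a) (fun y hy => by
      have := ht hy
      simp only [mem_iUnion] at this
      obtain ⟨a, ha, hya⟩ := this
      exact mem_iUnion.2 ⟨⟨a, ha⟩, hya⟩)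
  obtain ⟨a₀, ha₀⟩ : ∃ a, a ∈ t := by
    have := ht (mem_closedBall_self (x := (0 : Ed (Fin 3))) (Nat.cast_nonneg _))
    simp only [mem_iUnion] at this
    obtain ⟨a, ha, -⟩ := this
    exact ⟨a, ha⟩
  haveI : Nonempty t := ⟨⟨a₀, ha₀⟩⟩
  choose! sel hsel using hleb
  -- Step 4: the mesh
  -- (a) Lebesgue: `√3 / m < lam`
  obtain ⟨m₁, hm₁⟩ := exists_nat_gt (Real.sqrt (Fintype.card (Fin 3)) / lam)
  -- (b) oscillation of the test fields
  set η : ℝ := ε / (M + 1) with hη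
  have hη0 : 0 < η := by positivity
  have hosc : ∀ a : Fin N, ∃ m₀ : ℕ, 0 < m₀ ∧ ∀ m : ℕ, m₀ ≤ m → ∀ κ : Fin 3 → Fin m,
      ∀ y ∈ Torus.latticeCell m (gridIdx κ), ∀ y' ∈ Torus.latticeCell m (gridIdx κ),
        dist (p a y) (p a y') ≤ η := fun a => boxStep_exists_mesh_osc_le (hp a) hη0
  choose m₂ hm₂pos hm₂ using hosc
  set m : ℕ := m₁ + (Finset.univ.sup m₂) + 1 with hmdef
  have hm : 0 < m := by positivity
  have hm' : (0 : ℝ) < m := by exact_mod_cast hm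
  have hm_ge₁ : m₁ ≤ m := by omega
  have hm_ge₂ : ∀ a, m₂ a ≤ m := fun a => by
    have : m₂ a ≤ Finset.univ.sup m₂ := Finset.le_sup (Finset.mem_univ a)
    omega
  have hmesh : Real.sqrt (Fintype.card (Fin 3)) / m < lam := by
    have h1 : Real.sqrt (Fintype.card (Fin 3)) / lam < m := lt_of_lt_of_le hm₁ (by exact_mod_cast hm_ge₁)
    rw [div_lt_iff₀ hlam] at h1
    rw [div_lt_iff₀ hm']; linarith
  -- Step 5: the reference packets of the cells
  set Q : (Fin 3 → ℤ) → Packet (Fin 3) := fun κ => Pk (sel (corner frame0 m κ)) with hQ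
  have hQsupp : ∀ κ, Packet.SuppIn (box (Fin 3)) (Q κ) := fun κ => hPk_supp _
  -- cells are small: the cell `κ` is mapped into `O (sel (corner κ))`, and `sel (corner κ) ∈ t`
  have hcorner : ∀ κ : Fin 3 → Fin m, corner frame0 m (gridIdx κ) ∈ Kb := fun κ =>
    Torus.unitCube_subset_closedBall (Torus.latticeCell_subset_unitCube hm κ (corner_mem_latticeCell hm κ))
  have hcellO : ∀ κ : Fin 3 → Fin m, ∀ y ∈ Torus.latticeCell m (gridIdx κ),
      y ∈ O (sel (corner frame0 m (gridIdx κ))) := by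
    intro κ y hy
    have hball := hsel (corner frame0 m (gridIdx κ)) (hcorner κ)
    refine hball (mem_ball.2 ?_)
    rw [dist_eq_norm]
    exact lt_of_le_of_lt (Torus.norm_sub_le_of_mem_latticeCell hm (corner_mem_latticeCell hm κ) hy) hmesh
  have hQM : ∀ κ y, ‖Packet.field (Q κ) y‖ ≤ M := fun κ y => hMt _ (sel (corner frame0 m κ)).2 y
  refine ⟨m, hm, Q, hQsupp, fun x => ?_, fun a => ?_, fun x => ?_, ?_⟩
  · -- membership `w x + W x ∈ 𝒰_{e x}`
    by_cases hx : ∃ κ : Fin 3 → Fin m, x ∈ Torus.latticeCellInterior m (gridIdx κ)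
    · obtain ⟨κ, hxκ⟩ := hx
      set a := sel (corner frame0 m (gridIdx κ)) with ha
      obtain ⟨hex, hwx, -⟩ := hcellO κ x (Torus.latticeCellInterior_subset hxκ)
      have hadm : IsAdm (w x + Packet.field (gridPacket hm Q) x) := (hw x).1.add (Packet.isAdm_field _ x)
      have hval : Packet.field (gridPacket hm Q) x =
          Packet.field (Pk a) ((m : ℝ) • (x - corner frame0 m (gridIdx κ))) :=
        field_gridPacket_of_mem hm hQsupp hxκ
      refine hPk_marg a (e x) _ (by linarith [hδk a]) hadm ((m : ℝ) • (x - corner frame0 m (gridIdx κ))) ?_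
      rw [hval, dist_eq_norm, add_sub_add_right_eq_sub, ← dist_eq_norm]
      linarith [hδk a]
    · push Not at hx
      rw [field_gridPacket_eq_zero hm hQsupp hx, add_zero]
      exact hw x
  · -- near-orthogonality
    have h := boxStep_abs_integral_inner_field_gridPacket_le hm hQsupp hM0 hQM (hp a)
      fun κ y hy y' hy' => hm₂ a m (hm_ge₂ a) κ y hy y' hy'
    refine h.trans ?_
    rw [hη, mul_div_assoc', div_le_iff₀ (by positivity)]
    nlinarith
  · -- the pressure
    exact boxStep_abs_prC_placed_le frame0 hm (gridSet m) (fun κ _ => hQsupp κ) hδ.le (fun κ _ y => hPk_δ _ y) x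
  · -- the gain
    have hcell_gain : ∀ κ : Fin 3 → Fin m,
        g (sel (corner frame0 m (gridIdx κ))) - ε / 4 ≤ ∫ y, ‖Packet.field (Q (gridIdx κ)) y‖ ^ 2 := fun κ =>
      hPk_gain _
    -- `∫ ‖W‖² = Σ_κ m^{-d} ∫ ‖Q_κ‖²`
    rw [boxStep_integral_sq_field_gridPacket hm hQsupp]
    -- the defect over the box is at most the sum over the cells of the fundamental cube
    have hgi : IntegrableOn g (Torus.unitCube (Fin 3)) volume := Torus.integrableOn_unitCube_of_continuous hgc
    have hdef : ∫ x in box (Fin 3), g x ≤ ∑ κ : Fin 3 → Fin m, ∫ y in Torus.latticeCell m (gridIdx κ), g y := by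
      have h2 : ∫ x in Torus.unitCube (Fin 3), g x = ∑ κ : Fin 3 → Fin m, ∫ y in Torus.latticeCell m (gridIdx κ), g y :=
        Torus.setIntegral_unitCube_eq_sum_latticeCell hm hgi
      rw [← h2]
      exact setIntegral_mono_set hgi (ae_of_all _ hg0) boxStep_box_subset_unitCube.eventuallyLE
    have hvol : ∀ κ : Fin 3 → Fin m, volume.real (Torus.latticeCell m (gridIdx κ)) = ((m : ℝ)⁻¹) ^ Fintype.card (Fin 3) :=
      fun κ => by
        rw [measureReal_def, Torus.volume_latticeCell hm, ENNReal.toReal_pow, ENNReal.toReal_ofReal (inv_nonneg.2 hm'.le)]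
    have hcell_def : ∀ κ : Fin 3 → Fin m, ∫ y in Torus.latticeCell m (gridIdx κ), g y ≤
        ((m : ℝ)⁻¹) ^ Fintype.card (Fin 3) * (g (sel (corner frame0 m (gridIdx κ))) + ε / 4) := by
      intro κ
      have hint : IntegrableOn g (Torus.latticeCell m (gridIdx κ)) volume :=
        hgi.mono_set (Torus.latticeCell_subset_unitCube hm κ)
      calc ∫ y in Torus.latticeCell m (gridIdx κ), g y
          ≤ ∫ _y in Torus.latticeCell m (gridIdx κ), (g (sel (corner frame0 m (gridIdx κ))) + ε / 4) := by
            refine setIntegral_mono_on hint (integrableOn_const (Torus.volume_latticeCell_ne_top hm))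
              Torus.measurableSet_latticeCell fun y hy => ?_
            have := (hcellO κ y hy).2.2
            linarith [(abs_lt.1 this).2]
        _ = ((m : ℝ)⁻¹) ^ Fintype.card (Fin 3) * (g (sel (corner frame0 m (gridIdx κ))) + ε / 4) := by
            rw [setIntegral_const, hvol, smul_eq_mul]
    have hcount : ∑ _κ : Fin 3 → Fin m, ((m : ℝ)⁻¹) ^ Fintype.card (Fin 3) = 1 := by
      rw [Finset.sum_const, Finset.card_univ, Fintype.card_fun, Fintype.card_fin, nsmul_eq_mul, Nat.cast_pow, inv_pow,
        mul_inv_cancel₀ (pow_ne_zero _ hm'.ne')]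
    calc (∫ x in box (Fin 3), g x) - ε
        ≤ (∑ κ : Fin 3 → Fin m, ((m : ℝ)⁻¹) ^ Fintype.card (Fin 3) * (g (sel (corner frame0 m (gridIdx κ))) + ε / 4)) - ε := by
          linarith [hdef.trans (Finset.sum_le_sum fun κ _ => hcell_def κ)]
      _ = (∑ κ : Fin 3 → Fin m, ((m : ℝ)⁻¹) ^ Fintype.card (Fin 3) * (g (sel (corner frame0 m (gridIdx κ))) - ε / 4)) - ε / 2 := by
          have : ∀ κ : Fin 3 → Fin m, ((m : ℝ)⁻¹) ^ Fintype.card (Fin 3) * (g (sel (corner frame0 m (gridIdx κ))) + ε / 4) =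
              ((m : ℝ)⁻¹) ^ Fintype.card (Fin 3) * (g (sel (corner frame0 m (gridIdx κ))) - ε / 4) +
                ((m : ℝ)⁻¹) ^ Fintype.card (Fin 3) * (ε / 2) := fun κ => by ring
          simp_rw [this, Finset.sum_add_distrib, ← Finset.sum_mul, hcount]; ring
      _ ≤ ∑ κ : Fin 3 → Fin m, ((m : ℝ)⁻¹) ^ Fintype.card (Fin 3) * ∫ y, ‖Packet.field (Q (gridIdx κ)) y‖ ^ 2 := by
          have : ∑ κ : Fin 3 → Fin m, ((m : ℝ)⁻¹) ^ Fintype.card (Fin 3) * (g (sel (corner frame0 m (gridIdx κ))) - ε / 4) ≤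
              ∑ κ : Fin 3 → Fin m, ((m : ℝ)⁻¹) ^ Fintype.card (Fin 3) * ∫ y, ‖Packet.field (Q (gridIdx κ)) y‖ ^ 2 :=
            Finset.sum_le_sum fun κ _ => mul_le_mul_of_nonneg_left (hcell_gain κ) (by positivity)
          linarith

end Summit.AnomalousDissipation.AnomalousDissipation.Theorems

end
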